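import Summits.QuantumFields.YangMills.Theorems.UnitScaleTiltHalvingSmallMembersCoverLift
import Summits.QuantumFields.YangMills.Theorems.UnitScaleTiltWilsonActionFirstVariation
import Summits.QuantumFields.YangMills.Theorems.UnitScaleTiltProp7SymAvgRelativeDiff
import Summits.QuantumFields.YangMills.Theorems.UnitScaleTiltHalvingP1FlatCoreDP1Target
import Summits.QuantumFields.YangMills.Theorems.UnitScaleTiltProp7FirstVariationLog
import Summits.QuantumFields.YangMills.Theorems.UnitScaleTiltProp7CritEL
import Summits.QuantumFields.YangMills.Theorems.UnitScaleTiltProp7FlatRigidity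
import HarnessLib

/-!
# H-SMALL (b7) LIFT PACKAGE, FILE 3a: THE CHART CALCULUS OF THE TANGENT ROW — VELOCITIES OF PRODUCT CURVES, THE `log` CHART OF A CURVE THROUGH A
# REGULAR CONFIGURATION, AND ★★ «THE DIFFERENTIAL OF THE RELATIVE `(K−n)`-FOLD AVERAGE KILLS THE VELOCITY OF EVERY FIBRE CURVE»

Route (b7) «COVER LIFT» of ★★OWNER RULING №28 (2) ∕ №30 (4) for `stub_halvingStep` of stmt-QuantumFields-19200, tangent row `htan` of FILE 2b
(`SmallMembersCoverLiftStat.statLift_of_tangentLift`).  This file supplies the analysis letters FILE 3b (`…CoverLiftTangent.tangentLift`) assembles: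

* §1 `hasDerivAt_list_prod_one` — velocities ADD along an ordered product of matrix curves through `1` (product rule; no Lie algebra needed: the product of
  `SU(2)`-curves is an `SU(2)`-curve whose right-trivialised velocity is the sum of the factors' velocities).
* §2 `hasDerivAt_mlog_of_eq_one`, `eventually_norm_sub_one_lt` — the printed chart `A = (iη)⁻¹ log (U·U₀⁻¹)` ([Balaban1985Variational] (152) p.301) along a bondwise
  differentiable curve through `U₀`: `log` is differentiable at `1` with the identity as differential (`B7TransferAnalyticMean.hasFDerivAt_mlog_one`), and the
  curve stays in the domain `‖U·U₀⁻¹ − 1‖ < 1` of `exp ∘ log = id` for small times.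
* §3 `budget_of_small`, ★★ `hasDerivAt_coe_iter_along_curve` (the derivative of the GUARDED `(K−n)`-fold average along ANY bondwise-differentiable curve through
  `U₀ ∈ 𝔘_k(ε₀)`, read through the chart differential), ★★ `fderiv_relIter_velocity_eq_zero` — at a printed-regular `U₀ ∈ 𝔘_k(ε₀)` (`10¹⁰L⁶ε₀ ≤ 1`) and for a curve `γ` in the fibre `𝔅_k(V)` through `U₀`, bondwise
  differentiable at `0`, the ℂ-differential at `A = 0` of the relative `(K−n)`-fold (0.4) average in the chart `A ↦ Ū^{(K−n)}[e^{iA}U₀](e)·Ū^{(K−n)}[U₀](e)⁻¹`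
  (holomorphic there: ✓`Prop7SymAvgRelativeDiff.differentiableAt_relIter_of_plaqSmall`) KILLS the chart velocity `−i·γ̇(b)U₀(b)^*` of the curve, at every
  `(K−n)`-bond `e`: the fibre condition makes the average constant along `γ`, the guarded average is the unguarded iterate near `U₀`
  (✓`P1FlatCoreDP1Target.unitsField_toUField_iter_eq_emlIterU`, `𝔘_k` open ✓`Prop7CritEL.isOpen_regPr`), and the chain rule reads the derivative.

HONEST SCOPE: calculus bookkeeping at level `0` of one lattice `F.P K` (any `T3Family F`; FILE 3b applies it on the cover family `F.cover jc`); no estimate of print is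
re-proved.  Rung R3 of the ladder (YM₃ on T³ after Bałaban), not the Clay problem.

References: T. Bałaban, CMP **102** (1985) 277–309 [Balaban1985Variational] ((2)–(6) p.278, (152) p.301, (156) p.302); CMP **109** (1987) 249–301 [Balaban1987RG1]
((0.4) p.253, (0.11) p.253); CMP **98** (1985) 17–51 [Balaban1985Averaging] ((19) p.21).
-/

set_option autoImplicit false

noncomputable section

open scoped BigOperators Matrix.Norms.L2Operator Matrix Topology

namespace Summit.QuantumFields.YangMills.Theorems.SmallMembersCoverLiftTangentChart

open Literature.MathematicalPhysics.QuantumFieldTheory.Balaban1983to89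
open T4Continuum AveragingRT BlockAveraging ExpMeanLog MatrixLog
open T3ContinuumYM3Torus (T3Family)
open T3PrintedRegularMinimiser (RegPr)
open T3RegularMinimiser (regThreshold)
open T3ConstrainedMinimiser (fibre)
open T3TiltDescent (descendTo)
open T3UnitLawDensityEML (ℰp)
open B10Eq27TorusAxialLog (unitsField toUField val_unitsField)
open Summit.QuantumFields.YangMills.Theorems.Prop8Chart (expCfg coe_expCfg emlIterU)

/-! ## §1 Velocities add along products of curves through `1` -/

section Prod

/-- **VELOCITIES ADD ALONG AN ORDERED PRODUCT OF CURVES THROUGH `1`**: if every `c i` is a matrix curve with `c i 0 = 1` and velocity `c′ i` at `0`, the ordered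
product over a list has velocity the sum of the `c′ i` (product rule, all other factors equal to `1` at `0`). [folklore] -/
theorem hasDerivAt_list_prod_one {ι : Type*} (c : ι → ℝ → Matrix (Fin 2) (Fin 2) ℂ) (c' : ι → Matrix (Fin 2) (Fin 2) ℂ)
    (h0 : ∀ i, c i 0 = 1) (hc : ∀ i, HasDerivAt (c i) (c' i) 0) :
    ∀ l : List ι, HasDerivAt (fun s => (l.map fun i => c i s).prod) (l.map c').sum 0
  | [] => by simpa using hasDerivAt_const (0 : ℝ) (1 : Matrix (Fin 2) (Fin 2) ℂ)
  | i :: l => by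
      have ih := hasDerivAt_list_prod_one c c' h0 hc l
      have h1 : (l.map fun j => c j 0).prod = 1 := List.prod_eq_one (by
        intro x hx
        obtain ⟨j, _, rfl⟩ := List.mem_map.1 hx
        exact h0 j)
      have hmul := (hc i).mul ih
      rw [h0 i, h1, one_mul, mul_one] at hmul
      simp only [List.map_cons, List.prod_cons, List.sum_cons]
      exact hmul

end Prod

/-! ## §2 The `log` chart along a curve through the base point -/

section LogChart

/-- **THE `log` CHART IS TANGENT TO THE IDENTITY**: for a matrix curve `g` through `1`, differentiable at `0` with velocity `v`, `s ↦ log (g s)` has velocity `v`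
at `0` (`D log(1) = id`, ✓`B7TransferAnalyticMean.hasFDerivAt_mlog_one`, restricted to real times). [cite: Balaban1985Variational, (152) p.301] -/
theorem hasDerivAt_mlog_of_eq_one (g : ℝ → Matrix (Fin 2) (Fin 2) ℂ) (v : Matrix (Fin 2) (Fin 2) ℂ) (h0 : g 0 = 1) (hg : HasDerivAt g v 0) :
    HasDerivAt (fun s => mlog (g s)) v 0 := by
  have hlog : HasFDerivAt (mlog : Matrix (Fin 2) (Fin 2) ℂ → Matrix (Fin 2) (Fin 2) ℂ)
      ((1 : Matrix (Fin 2) (Fin 2) ℂ →L[ℂ] Matrix (Fin 2) (Fin 2) ℂ).restrictScalars ℝ) (g 0) := by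
    rw [h0]
    exact (B7TransferAnalyticMean.hasFDerivAt_mlog_one (𝔄 := Matrix (Fin 2) (Fin 2) ℂ)).restrictScalars ℝ
  have h := hlog.comp_hasDerivAt (0 : ℝ) hg
  simp only [ContinuousLinearMap.coe_restrictScalars', one_apply_eq_self] at h
  exact h

/-- **SMALL TIMES STAY IN THE CHART**: a matrix curve `g` through `1`, continuous at `0`, satisfies `‖g s − 1‖ < 1` for `s` near `0` (the domain of `exp ∘ log = id`). [folklore] -/
theorem eventually_norm_sub_one_lt (g : ℝ → Matrix (Fin 2) (Fin 2) ℂ) (h0 : g 0 = 1) (hg : ContinuousAt g 0) :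
    ∀ᶠ s in 𝓝 (0 : ℝ), ‖g s - 1‖ < 1 := by
  have h : ∀ᶠ s in 𝓝 (0 : ℝ), dist (g s) (g 0) < 1 := hg.eventually (Metric.ball_mem_nhds (g 0) one_pos)
  refine h.mono fun s hs => ?_
  rwa [h0, dist_eq_norm] at hs

end LogChart


/-! ## §3 The differential of the relative `(K−n)`-fold average kills fibre velocities -/

section Kill

open Summit.QuantumFields.YangMills.Theorems.Prop7SymAvgRelativeBound (differentiableAt_relIter_of_plaqSmall)
open Summit.QuantumFields.YangMills.Theorems.P1FlatCoreDP1Target (unitsField_toUField_iter_eq_emlIterU)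
open Summit.QuantumFields.YangMills.Theorems.Prop7CritEL (isOpen_regPr continuousAt_of_differentiableAt_bonds)
open Summit.QuantumFields.YangMills.Theorems.WilsonActionFirstVariation (hasDerivAt_mul_star_of_differentiableAt)
open Summit.QuantumFields.YangMills.Theorems.Prop7FirstVariationLog (exp_mlog_one_add_mul)
open T3RegularMinimiser (regThreshold_pos)

variable (F : T3Family) {n K : ℕ} (h : n ≤ K)

/-- The (AVG-SYM-AN) budget of ✓`differentiableAt_relIter_of_plaqSmall` at the origin of the chart (`t = 0`) over a printed-regular background (`a₀ = ε₀L^{−2(K−n)}`) is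
met under `10¹⁰L⁶ε₀ ≤ 1`: `6400·(5L)²·Lᵏ·6(3Lᵏ − 1)·ε₀L^{−2k} ≤ 2.88·10⁶·L²·ε₀ ≤ 1`. [cite: Balaban1985Variational, (2) p.278, (152) p.301] -/
theorem budget_of_small {ε₀ : ℝ} (hε₀ : 0 < ε₀) (hε : 10 ^ 10 * (F.L : ℝ) ^ 6 * ε₀ ≤ 1) :
    6400 * ((((F.P K).d + 2) * (F.P K).L : ℕ) : ℝ) ^ 2 * ((F.P K).L : ℝ) ^ (K - n) *
      (2 * (0 : ℝ) * (1 + 2 * ((((F.P K).d : ℕ) : ℝ) * (3 * ((F.P K).L : ℝ) ^ (K - n) - 1)) * regThreshold F n K ε₀) +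
        2 * ((((F.P K).d : ℕ) : ℝ) * (3 * ((F.P K).L : ℝ) ^ (K - n) - 1)) * regThreshold F n K ε₀) ≤ 1 := by
  rw [show (F.P K).L = F.L from rfl, show (F.P K).d = 3 from rfl]
  unfold T3RegularMinimiser.regThreshold
  have hL1 : (1 : ℝ) ≤ F.L := by have := F.hL.2; exact_mod_cast (by omega : 1 ≤ F.L)
  have hL0 : (0 : ℝ) < F.L := by linarith
  set x : ℝ := (F.L : ℝ) ^ (K - n) with hx
  have hx1 : 1 ≤ x := one_le_pow₀ hL1
  have hkey : ((F.L : ℝ)⁻¹) ^ (2 * (K - n)) * x * x = 1 := by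
    rw [hx, inv_pow, mul_assoc, ← pow_add, ← two_mul, inv_mul_cancel₀ (pow_ne_zero _ hL0.ne')]
  have hL2 : (F.L : ℝ) ^ 2 ≤ (F.L : ℝ) ^ 6 := pow_le_pow_right₀ hL1 (by norm_num)
  calc 6400 * (((3 + 2) * F.L : ℕ) : ℝ) ^ 2 * x *
        (2 * (0 : ℝ) * (1 + 2 * (((3 : ℕ) : ℝ) * (3 * x - 1)) * (ε₀ * ((F.L : ℝ)⁻¹) ^ (2 * (K - n)))) +
          2 * (((3 : ℕ) : ℝ) * (3 * x - 1)) * (ε₀ * ((F.L : ℝ)⁻¹) ^ (2 * (K - n))))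
        ≤ 6400 * (((3 + 2) * F.L : ℕ) : ℝ) ^ 2 * x * (2 * (0 : ℝ) * (1 + 2 * (((3 : ℕ) : ℝ) * (3 * x - 1)) * (ε₀ * ((F.L : ℝ)⁻¹) ^ (2 * (K - n)))) +
          2 * (((3 : ℕ) : ℝ) * (3 * x)) * (ε₀ * ((F.L : ℝ)⁻¹) ^ (2 * (K - n)))) := by
          gcongr
          linarith
    _ = 2880000 * (F.L : ℝ) ^ 2 * ε₀ * (((F.L : ℝ)⁻¹) ^ (2 * (K - n)) * x * x) := by push_cast; ring
    _ = 2880000 * (F.L : ℝ) ^ 2 * ε₀ := by rw [hkey, mul_one]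
    _ ≤ 10 ^ 10 * (F.L : ℝ) ^ 6 * ε₀ := by nlinarith [hε₀.le, hL2]
    _ ≤ 1 := hε

/-- ★★ **THE DERIVATIVE OF THE GUARDED `(K−n)`-FOLD AVERAGE ALONG A CURVE, READ IN THE CHART.**  Let `U₀ ∈ 𝔘_k(ε₀)` (print's (2), `10¹⁰L⁶ε₀ ≤ 1`) and let `Γ` be
ANY curve of configurations through `U₀`, every bond variable differentiable at `0` (read in `M₂(ℂ)`).  In the chart `A ↦ e^{iA}U₀` ([Balaban1985Variational] (152), `η = 1`)
the relative `(K−n)`-fold (0.4) average `Φ_e(A) := Ū^{(K−n)}[e^{iA}U₀](e)·Ū^{(K−n)}[U₀](e)⁻¹` is ℂ-differentiable at `A = 0` (✓`differentiableAt_relIter_of_plaqSmall`, budget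
`budget_of_small`), and the bond variable `s ↦ Ū^{(K−n)}[Γ(s)](e)` of the GUARDED average (`Averaging.iter (blockAvg ℰp)`) has derivative
`DΦ_e(0)[−i·Γ̇U₀^*]·Ū^{(K−n)}[U₀](e)` at `s = 0`: along `Γ` the chart coordinate `A(s) = −i log(Γ(s)U₀^*)` is differentiable with velocity `−i·Γ̇(b)U₀(b)^*` (§2),
`e^{iA(s)}U₀ = Γ(s)` for small `s`, the curve stays in the open set `𝔘_k(ε₀)` (✓`isOpen_regPr`) where the guarded average IS the unguarded iterate
(✓`unitsField_toUField_iter_eq_emlIterU`), and the chain rule reads the derivative. [cite: Balaban1985Variational, (2) p.278, (152) p.301, (156) p.302; Balaban1987RG1, (0.11) p.253] -/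
theorem hasDerivAt_coe_iter_along_curve {ε₀ : ℝ} (hε₀ : 0 < ε₀) (hε : 10 ^ 10 * (F.L : ℝ) ^ 6 * ε₀ ≤ 1)
    (U₀ : GaugeField (F.P K) 0 (Matrix.specialUnitaryGroup (Fin 2) ℂ)) (hU₀ : RegPr F n K ε₀ U₀)
    (Γ : ℝ → GaugeField (F.P K) 0 (Matrix.specialUnitaryGroup (Fin 2) ℂ)) (hΓ0 : Γ 0 = U₀)
    (hΓd : ∀ b, DifferentiableAt ℝ (fun t => ((Γ t b : Matrix.specialUnitaryGroup (Fin 2) ℂ) : Matrix (Fin 2) (Fin 2) ℂ)) 0)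
    (e : PBond (F.P K) (K - n)) :
    HasDerivAt (fun s : ℝ => ((Averaging.iter (fun i => blockAvg (P := F.P K) (j := i) ℰp) (K - n) (Γ s) e : Matrix.specialUnitaryGroup (Fin 2) ℂ) :
        Matrix (Fin 2) (Fin 2) ℂ))
      ((fderiv ℂ (fun A : PBond (F.P K) 0 → Matrix (Fin 2) (Fin 2) ℂ =>
          ((emlIterU (K - n) (fun b => expCfg 1 A b * unitsField (toUField U₀) b) e : (Matrix (Fin 2) (Fin 2) ℂ)ˣ) : Matrix (Fin 2) (Fin 2) ℂ) *
            (((emlIterU (K - n) (unitsField (toUField U₀)) e)⁻¹ : (Matrix (Fin 2) (Fin 2) ℂ)ˣ) : Matrix (Fin 2) (Fin 2) ℂ)) 0)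
          (fun b => (-Complex.I) • (deriv (fun t => ((Γ t b : Matrix.specialUnitaryGroup (Fin 2) ℂ) : Matrix (Fin 2) (Fin 2) ℂ)) 0 *
            star ((U₀ b : Matrix.specialUnitaryGroup (Fin 2) ℂ) : Matrix (Fin 2) (Fin 2) ℂ))) *
        ((emlIterU (K - n) (unitsField (toUField U₀)) e : (Matrix (Fin 2) (Fin 2) ℂ)ˣ) : Matrix (Fin 2) (Fin 2) ℂ)) 0 := by
  set Φ : (PBond (F.P K) 0 → Matrix (Fin 2) (Fin 2) ℂ) → Matrix (Fin 2) (Fin 2) ℂ := fun A =>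
    ((emlIterU (K - n) (fun b => expCfg 1 A b * unitsField (toUField U₀) b) e : (Matrix (Fin 2) (Fin 2) ℂ)ˣ) : Matrix (Fin 2) (Fin 2) ℂ) *
      (((emlIterU (K - n) (unitsField (toUField U₀)) e)⁻¹ : (Matrix (Fin 2) (Fin 2) ℂ)ˣ) : Matrix (Fin 2) (Fin 2) ℂ) with hΦ
  set C : (Matrix (Fin 2) (Fin 2) ℂ)ˣ := emlIterU (K - n) (unitsField (toUField U₀)) e with hC
  -- (a) `Φ` is ℂ-differentiable at the origin of the chart
  have hkm : K - n + 1 ≤ (F.P K).m + (F.P K).K := by show K - n + 1 ≤ F.m + K; have := F.hm; omega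
  have hdiff : DifferentiableAt ℂ Φ 0 :=
    differentiableAt_relIter_of_plaqSmall hkm U₀ (regThreshold_pos F (n := n) (K := K) hε₀) hU₀.plaqSmall 1 0 (t := 0) zero_le_one
      (fun b => by rw [Pi.zero_apply, smul_zero, norm_zero]) (budget_of_small F hε₀ hε) e
  have hΦ' : HasFDerivAt Φ (fderiv ℂ Φ 0) 0 := hdiff.hasFDerivAt
  -- (b) the chart coordinate of the curve and its velocity
  set ξ : PBond (F.P K) 0 → Matrix (Fin 2) (Fin 2) ℂ := fun b =>
    deriv (fun t => ((Γ t b : Matrix.specialUnitaryGroup (Fin 2) ℂ) : Matrix (Fin 2) (Fin 2) ℂ)) 0 *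
      star ((U₀ b : Matrix.specialUnitaryGroup (Fin 2) ℂ) : Matrix (Fin 2) (Fin 2) ℂ) with hξ
  set g : PBond (F.P K) 0 → ℝ → Matrix (Fin 2) (Fin 2) ℂ := fun b s =>
    ((Γ s b : Matrix.specialUnitaryGroup (Fin 2) ℂ) : Matrix (Fin 2) (Fin 2) ℂ) * star ((U₀ b : Matrix.specialUnitaryGroup (Fin 2) ℂ) : Matrix (Fin 2) (Fin 2) ℂ)
    with hg
  have hUU : ∀ b, ((U₀ b : Matrix.specialUnitaryGroup (Fin 2) ℂ) : Matrix (Fin 2) (Fin 2) ℂ) * star ((U₀ b : Matrix.specialUnitaryGroup (Fin 2) ℂ) : Matrix (Fin 2) (Fin 2) ℂ) = 1 :=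
    fun b => Matrix.mem_unitaryGroup_iff.mp (U₀ b).2.1
  have hUU' : ∀ b, star ((U₀ b : Matrix.specialUnitaryGroup (Fin 2) ℂ) : Matrix (Fin 2) (Fin 2) ℂ) * ((U₀ b : Matrix.specialUnitaryGroup (Fin 2) ℂ) : Matrix (Fin 2) (Fin 2) ℂ) = 1 :=
    fun b => Matrix.mem_unitaryGroup_iff'.mp (U₀ b).2.1
  have hg0 : ∀ b, g b 0 = 1 := fun b => by rw [hg]; dsimp only; rw [hΓ0]; exact hUU b
  have hgd : ∀ b, HasDerivAt (g b) (ξ b) 0 := fun b => hasDerivAt_mul_star_of_differentiableAt Γ U₀ b (hΓd b)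
  set α : ℝ → PBond (F.P K) 0 → Matrix (Fin 2) (Fin 2) ℂ := fun s b => (-Complex.I) • mlog (g b s) with hα
  have hα0 : α 0 = 0 := by
    funext b
    rw [hα]; dsimp only
    rw [hg0 b, mlog_one, smul_zero, Pi.zero_apply]
  have hαd : HasDerivAt α (fun b => (-Complex.I) • ξ b) 0 :=
    hasDerivAt_pi.2 fun b => (hasDerivAt_mlog_of_eq_one (g b) (ξ b) (hg0 b) (hgd b)).const_smul (-Complex.I)
  -- (c) `Φ (α s) · C` is the guarded average near `0`
  have hΓc : ContinuousAt Γ 0 := continuousAt_of_differentiableAt_bonds Γ hΓd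
  have hreg : ∀ᶠ s in 𝓝 (0 : ℝ), RegPr F n K ε₀ (Γ s) := by
    have hO : {U : GaugeField (F.P K) 0 (Matrix.specialUnitaryGroup (Fin 2) ℂ) | RegPr F n K ε₀ U} ∈ 𝓝 (Γ 0) := by
      rw [hΓ0]; exact (isOpen_regPr F n K ε₀).mem_nhds hU₀
    exact hΓc.preimage_mem_nhds hO
  have hsmall : ∀ᶠ s in 𝓝 (0 : ℝ), ∀ b, ‖g b s - 1‖ < 1 :=
    Filter.eventually_all.2 fun b => eventually_norm_sub_one_lt (g b) (hg0 b) (hgd b).continuousAt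
  have hL1 : (1 : ℝ) ≤ F.L := by have := F.hL.2; exact_mod_cast (by omega : 1 ≤ F.L)
  have hε7 : 10 ^ 7 * (F.L : ℝ) ^ 3 * ε₀ ≤ 1 := by
    have h36 : (F.L : ℝ) ^ 3 ≤ (F.L : ℝ) ^ 6 := pow_le_pow_right₀ hL1 (by norm_num)
    nlinarith [hε₀.le, h36]
  have hval : ∀ᶠ s in 𝓝 (0 : ℝ), Φ (α s) * (C : Matrix (Fin 2) (Fin 2) ℂ) =
      ((Averaging.iter (fun i => blockAvg (P := F.P K) (j := i) ℰp) (K - n) (Γ s) e : Matrix.specialUnitaryGroup (Fin 2) ℂ) : Matrix (Fin 2) (Fin 2) ℂ) := by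
    filter_upwards [hreg, hsmall] with s hs hsm
    have hfield : (fun b => expCfg 1 (α s) b * unitsField (toUField U₀) b) = unitsField (toUField (Γ s)) := by
      funext b
      apply Units.ext
      rw [Units.val_mul, coe_expCfg, val_unitsField, val_unitsField, hα]
      dsimp only
      rw [smul_smul, Complex.ofReal_one, mul_one, show Complex.I * -Complex.I = 1 by rw [mul_neg, Complex.I_mul_I, neg_neg], one_smul]
      have hexp := exp_mlog_one_add_mul (g b s - 1) ((U₀ b : Matrix.specialUnitaryGroup (Fin 2) ℂ) : Matrix (Fin 2) (Fin 2) ℂ) (hsm b)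
      rw [add_sub_cancel] at hexp
      show NormedSpace.exp (mlog (g b s)) * ((U₀ b : Matrix.specialUnitaryGroup (Fin 2) ℂ) : Matrix (Fin 2) (Fin 2) ℂ) =
        ((Γ s b : Matrix.specialUnitaryGroup (Fin 2) ℂ) : Matrix (Fin 2) (Fin 2) ℂ)
      rw [hexp, hg]; dsimp only
      rw [mul_assoc, hUU' b, mul_one]
    rw [hΦ, hC]; dsimp only
    rw [Units.inv_mul_cancel_right, hfield, ← unitsField_toUField_iter_eq_emlIterU F n K hε₀ hε7 (Γ s) hs.plaqSmall (K - n) le_rfl, val_unitsField]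
    rfl
  -- (d) the chain rule
  have h1 : HasDerivAt (Φ ∘ α) ((fderiv ℂ Φ 0) (fun b => (-Complex.I) • ξ b)) 0 := by
    have hc := (hΦ'.restrictScalars ℝ).comp_hasDerivAt_of_eq (0 : ℝ) hαd hα0.symm
    simpa only [ContinuousLinearMap.coe_restrictScalars'] using hc
  exact (h1.mul_const (C : Matrix (Fin 2) (Fin 2) ℂ)).congr_of_eventuallyEq (hval.mono fun s hs => hs.symm)

/-- ★★ **THE DIFFERENTIAL OF THE RELATIVE `(K−n)`-FOLD AVERAGE KILLS THE VELOCITY OF EVERY FIBRE CURVE.**  For a curve `γ` IN THE FIBRE `𝔅_k(V)` through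
`U₀ ∈ 𝔘_k(ε₀)` (bondwise differentiable at `0`), the guarded `(K−n)`-fold average is constant along `γ` (✓`Prop7FlatRigidity.iter_eq_of_mem_fibre`), so by
`hasDerivAt_coe_iter_along_curve` and uniqueness of derivatives `DΦ_e(0)[−i·γ̇U₀^*]·Ū^{(K−n)}[U₀](e) = 0`; the last factor is a unit.
[cite: Balaban1985Variational, (2)-(3) p.278, (152) p.301, (156) p.302; Balaban1987RG1, (0.11) p.253] -/
theorem fderiv_relIter_velocity_eq_zero {ε₀ : ℝ} (hε₀ : 0 < ε₀) (hε : 10 ^ 10 * (F.L : ℝ) ^ 6 * ε₀ ≤ 1)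
    (V : GaugeField (F.P n) 0 (Matrix.specialUnitaryGroup (Fin 2) ℂ)) (U₀ : GaugeField (F.P K) 0 (Matrix.specialUnitaryGroup (Fin 2) ℂ))
    (hU₀ : RegPr F n K ε₀ U₀) (γ : ℝ → GaugeField (F.P K) 0 (Matrix.specialUnitaryGroup (Fin 2) ℂ)) (hγ0 : γ 0 = U₀)
    (hγfib : ∀ t, γ t ∈ fibre F ℰp n K h V)
    (hγd : ∀ b, DifferentiableAt ℝ (fun t => ((γ t b : Matrix.specialUnitaryGroup (Fin 2) ℂ) : Matrix (Fin 2) (Fin 2) ℂ)) 0)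
    (e : PBond (F.P K) (K - n)) :
    (fderiv ℂ (fun A : PBond (F.P K) 0 → Matrix (Fin 2) (Fin 2) ℂ =>
        ((emlIterU (K - n) (fun b => expCfg 1 A b * unitsField (toUField U₀) b) e : (Matrix (Fin 2) (Fin 2) ℂ)ˣ) : Matrix (Fin 2) (Fin 2) ℂ) *
          (((emlIterU (K - n) (unitsField (toUField U₀)) e)⁻¹ : (Matrix (Fin 2) (Fin 2) ℂ)ˣ) : Matrix (Fin 2) (Fin 2) ℂ)) 0)
      (fun b => (-Complex.I) • (deriv (fun t => ((γ t b : Matrix.specialUnitaryGroup (Fin 2) ℂ) : Matrix (Fin 2) (Fin 2) ℂ)) 0 *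
        star ((U₀ b : Matrix.specialUnitaryGroup (Fin 2) ℂ) : Matrix (Fin 2) (Fin 2) ℂ))) = 0 := by
  have h1 := hasDerivAt_coe_iter_along_curve F hε₀ hε U₀ hU₀ γ hγ0 hγd e
  have hU₀fib : U₀ ∈ fibre F ℰp n K h V := hγ0 ▸ hγfib 0
  -- the guarded average is constant along the fibre curve
  have hconst : (fun s : ℝ => ((Averaging.iter (fun i => blockAvg (P := F.P K) (j := i) ℰp) (K - n) (γ s) e : Matrix.specialUnitaryGroup (Fin 2) ℂ) :
      Matrix (Fin 2) (Fin 2) ℂ)) = fun _ => ((Averaging.iter (fun i => blockAvg (P := F.P K) (j := i) ℰp) (K - n) U₀ e : Matrix.specialUnitaryGroup (Fin 2) ℂ) :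
      Matrix (Fin 2) (Fin 2) ℂ) := by
    funext s; rw [Prop7FlatRigidity.iter_eq_of_mem_fibre F h ℰp (hγfib s) hU₀fib]
  rw [hconst] at h1
  have h0 := h1.unique (hasDerivAt_const (0 : ℝ) _)
  -- cancel the unit `Ū^{(K−n)}[U₀](e)`
  have h := congrArg (fun M : Matrix (Fin 2) (Fin 2) ℂ => M * (((emlIterU (K - n) (unitsField (toUField U₀)) e)⁻¹ : (Matrix (Fin 2) (Fin 2) ℂ)ˣ) : Matrix (Fin 2) (Fin 2) ℂ)) h0
  simpa only [Units.mul_inv_cancel_right, zero_mul] using h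

end Kill

end Summit.QuantumFields.YangMills.Theorems.SmallMembersCoverLiftTangentChart
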